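import Mathlib.Topology.Algebra.InfiniteSum.NatInt
import Mathlib.Topology.Instances.ENNReal.Lemmas
import Mathlib.Data.Sign.Basic
import Mathlib.Data.Fintype.Option
import Mathlib.Data.Fintype.BigOperators
import Mathlib.MeasureTheory.Integral.Bochner.SumMeasure
import Mathlib.MeasureTheory.Measure.Count
import HarnessLib

/-!
# The Fröhlich–Spencer resummation of `ℤ^L` (the `z_q` device, FS82 (2.37)–(2.40))

Support file for the sine-Gordon / Coulomb-gas representation of abelian lattice models at weak
coupling (proof programme of the named fact
`Literature.MathematicalPhysics.QuantumFieldTheory.FrohlichSpencerU1PerimeterLawD4` and of its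
corollary `Literature.Barriers.QuantumFields.AbelianDeconfinementD4`; the same device opens FS81 §6
for the cosine action, (6.7)–(6.8)). FS82 §2.6 applies the Poisson summation formula
`∑_n δ(α - 2πn) = (2π)⁻¹ (1 + 2 ∑_{q≥1} cos(qα))` ((2.37)) link by link and then writes, for a
sequence `{z_q}` with `∑_{q≥1} 2 z_q⁻¹ = 1` ((2.38)),
`1 + 2 ∑_{q≥1} cos(q α_{xy}) = ∑_{q≥1} 2 z_q⁻¹ (1 + z_q cos(q α_{xy}))`, so that the dual Gibbs factor
becomes a positive superposition over assignments `xy ↦ q_{xy} ≥ 1` of the products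
`∏_{xy} (1 + z_{q_{xy}} cos(q_{xy} α_{xy}))` ((2.39)–(2.40)) — the input of Lemma 2
(`FrohlichSpencerEnsembleExpansion`).

Pointwise these are identities between divergent series; what is actually used is the
corresponding REARRANGEMENT of an absolutely convergent sum over `ℤ^L` (the Fourier side): with
`u_q = 2/z_q` (`u_0 = 0`, `∑ u_q = 1`; only `∑ u_q = 1` is used below) and the per-link weights `w(k, 0) = u_k`, `w(k, ±1) = 1`
(`k ≥ 1`), every `q ∈ ℤ^L` is hit by the pairs `(κ, s) ∈ ℕ^L × {0,±1}^L` with `s·κ = q` with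
total weight `∏_{l : q_l = 0} (∑_k u_k) · ∏_{l : q_l ≠ 0} 1 = 1`. We prove:

* `tsum_int_eq_tsum_pairWeight` (one link) and `tsum_eq_tsum_sum_pairWeight` (**`L` links,
  `ℝ≥0∞`-valued**): `∑'_{q ∈ ℤ^L} T q = ∑'_{κ ∈ ℕ^L} ∑_{s ∈ {0,±1}^L} (∏_l w(κ_l, s_l)) T(s·κ)`,
  by induction on the links;
* `count_eq_sum_pairWeight_dirac` (the same as an identity of measures on `ℤ^L`:
  `count = ∑_{(κ,s)} (∏ w) δ_{s·κ}`);
* `tsum_eq_tsum_pairWeight_of_summable` (**complex-valued, absolutely summable `T`**, summed over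
  the pairs `(κ, s)`).

With `T(q) = ∫ e^{i(α, 2πq)} Φ dμ` and `∏_l w(κ_l,s_l) = (∏_l u_{κ_l}) · ∏_l a_{z_{κ_l}}(s_l)`
(`a_z(0) = 1`, `a_z(±1) = z/2`, `z_k = 2/u_k`), the sum over `s` at fixed `κ` is
`(∏ 2z⁻¹) ∫ ∏_l (1 + z_{κ_l} cos(2π κ_l α_l)) Φ dμ` by the signed expansion of
`GaussianCoordIntegration` (`prod_one_add_mul_cos_eq_sum`), which is (2.40). Everything is proved;
no named fact is introduced.

## References

* J. Fröhlich, T. Spencer, Comm. Math. Phys. 83 (1982) 411–454, §2.6 (2.37)–(2.40), p. 424.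
  [FrohlichSpencerCMP1982]
* J. Fröhlich, T. Spencer, Comm. Math. Phys. 81 (1981) 527–602, §6 (6.7)–(6.8). [FrohlichSpencerKT1981]
-/

noncomputable section

open MeasureTheory Finset
open scoped BigOperators ENNReal

namespace Literature.Probability.LatticeModels

namespace EnsembleExpansion

/-! ### The per-link weights -/

/-- The weight of the pair `(k, s)`: `u_k` for `s = 0` (the term `2z_k⁻¹ · 1`), `1` for `s = ±1`
and `k ≥ 1` (the terms `2z_k⁻¹ · (z_k/2) e^{±ikα}`), `0` for `k = 0`, `s = ±1` (no such term).
[cite: FrohlichSpencerCMP1982, (2.38)–(2.39)] -/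
def pairWeight (u : ℕ → ℝ≥0∞) (k : ℕ) (s : SignType) : ℝ≥0∞ :=
  if s = 0 then u k else if k = 0 then 0 else 1

/-- The signed multiple `s·κ ∈ ℤ^L` of `κ ∈ ℕ^L` by `s ∈ {0,±1}^L`. [folklore] -/
def signMul {L : Type*} (s : L → SignType) (κ : L → ℕ) : L → ℤ := fun l => (s l : ℤ) * κ l

/-- Sum over the three signs. [folklore] -/
theorem sum_signType {M : Type*} [AddCommMonoid M] (f : SignType → M) :
    ∑ s, f s = f 0 + f (-1) + f 1 := by
  rw [SignType.univ_eq, Finset.sum_insert (by decide), Finset.sum_insert (by decide),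
    Finset.sum_singleton]
  abel

/-- `pairWeight` is finite when `∑' u = 1`. [folklore] -/
theorem pairWeight_ne_top {u : ℕ → ℝ≥0∞} (hu : ∑' k, u k = 1) (k : ℕ) (s : SignType) :
    pairWeight u k s ≠ ∞ := by
  unfold pairWeight
  split_ifs
  · exact ne_top_of_le_ne_top ENNReal.one_ne_top (hu ▸ ENNReal.le_tsum k)
  · exact ENNReal.zero_ne_top
  · exact ENNReal.one_ne_top

/-! ### One link -/

/-- **The resummation of `ℤ`** (one link): for `U : ℤ → ℝ≥0∞` and weights `u` with `∑' u = 1`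
(in FS82 `u_0 = 0`, `u_k = 2/z_k`; the hypothesis `u 0 = 0` is not needed):
`∑'_{q∈ℤ} U q = ∑'_{k∈ℕ} ∑_{s} w(k,s) U(s k)`. [cite: FrohlichSpencerCMP1982, (2.38) p. 424] -/
theorem tsum_int_eq_tsum_pairWeight (u : ℕ → ℝ≥0∞) (hu : ∑' k, u k = 1)
    (U : ℤ → ℝ≥0∞) :
    ∑' q : ℤ, U q = ∑' k : ℕ, ∑ s : SignType, pairWeight u k s * U ((s : ℤ) * k) := by
  set V : ℕ → ℝ≥0∞ := fun k => if k = 0 then 0 else U k + U (-(k : ℤ)) with hV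
  have hR : ∀ k : ℕ, ∑ s : SignType, pairWeight u k s * U ((s : ℤ) * k) = u k * U 0 + V k := by
    intro k
    rw [sum_signType]
    by_cases hk : k = 0
    · subst hk
      simp [pairWeight, hV]
    · simp only [pairWeight, hV, hk, if_true, if_false, SignType.coe_zero, zero_mul,
        SignType.coe_neg_one, neg_one_mul, SignType.coe_one, one_mul, SignType.neg_eq_zero_iff,
        one_ne_zero]
      ring
  simp_rw [hR]
  rw [ENNReal.tsum_add, ENNReal.tsum_mul_right, hu, one_mul]
  have hVsum : ∑' k, V k = ∑' n : ℕ, (U ((n + 1 : ℕ) : ℤ) + U (-((n + 1 : ℕ) : ℤ))) := by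
    rw [tsum_eq_zero_add' (f := V) ENNReal.summable]
    simp [hV]
  have hL : ∑' q : ℤ, U q = U 0 + ∑' n : ℕ, (U ((n + 1 : ℕ) : ℤ) + U (-((n + 1 : ℕ) : ℤ))) := by
    rw [tsum_of_nat_of_neg_add_one (f := U) ENNReal.summable ENNReal.summable, ENNReal.tsum_add,
      tsum_eq_zero_add' (f := fun n : ℕ => U n) ENNReal.summable, add_assoc]
    simp only [Nat.cast_zero, Nat.cast_succ]
  rw [hL, hVsum]

/-! ### `L` links (`ℝ≥0∞`-valued) -/

/-- The resummation statement for the link type `L`. [folklore] -/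
def ResumStatement (u : ℕ → ℝ≥0∞) (L : Type*) [Fintype L] [DecidableEq L] : Prop :=
  ∀ T : (L → ℤ) → ℝ≥0∞,
    ∑' q : L → ℤ, T q =
      ∑' κ : L → ℕ, ∑ s : L → SignType, (∏ l, pairWeight u (κ l) (s l)) * T (signMul s κ)

/-- Transport of the statement along an equivalence of link types. [folklore] -/
theorem resumStatement_of_equiv (u : ℕ → ℝ≥0∞) {α β : Type*} [Fintype α] [DecidableEq α]
    [Fintype β] [DecidableEq β] (e : α ≃ β) (h : ResumStatement u α) : ResumStatement u β := by
  intro T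
  let E : (α → ℤ) ≃ (β → ℤ) := Equiv.piCongrLeft' (fun _ => ℤ) e
  let Eκ : (α → ℕ) ≃ (β → ℕ) := Equiv.piCongrLeft' (fun _ => ℕ) e
  let Es : (α → SignType) ≃ (β → SignType) := Equiv.piCongrLeft' (fun _ => SignType) e
  rw [← E.tsum_eq, h (fun f => T (E f)), ← Eκ.tsum_eq]
  refine tsum_congr fun κ' => ?_
  rw [← Fintype.sum_equiv Es _ (fun s => (∏ l, pairWeight u (Eκ κ' l) (s l)) * T (signMul s (Eκ κ')))
    (fun s' => rfl)]
  refine Finset.sum_congr rfl fun s' _ => ?_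
  have hT : T (E (signMul s' κ')) = T (signMul (Es s') (Eκ κ')) := rfl
  rw [hT]
  congr 1
  exact Fintype.prod_equiv e _ _ fun a => by
    show pairWeight u (κ' a) (s' a) = pairWeight u (κ' (e.symm (e a))) (s' (e.symm (e a)))
    rw [Equiv.symm_apply_apply]

/-- The statement for no links. [folklore] -/
theorem resumStatement_pempty (u : ℕ → ℝ≥0∞) : ResumStatement u PEmpty := by
  intro T
  rw [tsum_fintype, tsum_fintype, Fintype.sum_unique, Fintype.sum_unique, Fintype.sum_unique,
    Finset.prod_of_isEmpty, one_mul]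
  congr 1
  exact Subsingleton.elim _ _

/-- The inductive step: adding one link. [cite: FrohlichSpencerCMP1982, (2.39)–(2.40)] -/
theorem resumStatement_option (u : ℕ → ℝ≥0∞) (hu : ∑' k, u k = 1) {α : Type*}
    [Fintype α] [DecidableEq α] (h : ResumStatement u α) : ResumStatement u (Option α) := by
  intro T
  let E : (Option α → ℤ) ≃ ℤ × (α → ℤ) := Equiv.piOptionEquivProd
  let Eκ : (Option α → ℕ) ≃ ℕ × (α → ℕ) := Equiv.piOptionEquivProd
  let Es : (Option α → SignType) ≃ SignType × (α → SignType) := Equiv.piOptionEquivProd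
  -- split off the new coordinate on the left
  rw [← E.symm.tsum_eq, ENNReal.tsum_prod']
  have hinner : ∀ q₀ : ℤ, ∑' q' : α → ℤ, T (E.symm (q₀, q')) =
      ∑' κ' : α → ℕ, ∑ s' : α → SignType,
        (∏ a, pairWeight u (κ' a) (s' a)) * T (E.symm (q₀, signMul s' κ')) :=
    fun q₀ => h fun q' => T (E.symm (q₀, q'))
  simp_rw [hinner]
  rw [tsum_int_eq_tsum_pairWeight u hu]
  -- split off the new coordinate on the right
  rw [← Eκ.symm.tsum_eq, ENNReal.tsum_prod']
  refine tsum_congr fun k => ?_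
  simp_rw [← ENNReal.tsum_mul_left, Finset.mul_sum]
  rw [← tsum_fintype (L := SummationFilter.unconditional _), ENNReal.tsum_comm]
  simp_rw [tsum_fintype]
  refine tsum_congr fun κ' => ?_
  rw [← Fintype.sum_equiv Es.symm (fun p => (∏ l, pairWeight u (Eκ.symm (k, κ') l) ((Es.symm p) l)) *
      T (signMul (Es.symm p) (Eκ.symm (k, κ')))) _ (fun _ => rfl), Fintype.sum_prod_type]
  refine Finset.sum_congr rfl fun s₀ _ => Finset.sum_congr rfl fun s' _ => ?_
  rw [← mul_assoc]
  congr 1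
  · rw [Fintype.prod_option]
    rfl
  · congr 1
    funext o
    cases o <;> rfl

/-- **The Fröhlich–Spencer resummation of `ℤ^L`, `ℝ≥0∞`-valued.** For weights `u` with
`∑' u = 1` and every `T : ℤ^L → [0, ∞]`,
`∑'_{q} T q = ∑'_{κ ∈ ℕ^L} ∑_{s ∈ {0,±1}^L} (∏_l w(κ_l, s_l)) T(s·κ)`.
[cite: FrohlichSpencerCMP1982, §2.6 (2.37)–(2.40) p. 424] -/
theorem tsum_eq_tsum_sum_pairWeight (u : ℕ → ℝ≥0∞) (hu : ∑' k, u k = 1)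
    (L : Type*) [Fintype L] [DecidableEq L] : ResumStatement u L := by
  -- the statement does not depend on the decidability instance
  have hdec : ∀ (α : Type _) [Fintype α] (d₁ d₂ : DecidableEq α),
      @ResumStatement u α _ d₁ → @ResumStatement u α _ d₂ := by
    intro α _ d₁ d₂ h
    cases Subsingleton.elim d₁ d₂
    exact h
  have key : ∀ (α : Type _) [Fintype α], @ResumStatement u α _ (Classical.decEq α) := by
    intro α _
    refine Fintype.induction_empty_option
      (P := fun (α : Type _) (_ : Fintype α) => @ResumStatement u α _ (Classical.decEq α)) ?_ ?_ ?_ α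
    · intro α β _ e hα
      letI : Fintype α := Fintype.ofEquiv β e.symm
      exact @resumStatement_of_equiv u α β _ (Classical.decEq α) _ (Classical.decEq β) e hα
    · exact hdec PEmpty _ _ (resumStatement_pempty u)
    · intro α _ hα
      exact hdec (Option α) _ _ (@resumStatement_option u hu α _ (Classical.decEq α) hα)
  exact hdec L _ _ (key L)

/-! ### As an identity of measures, and for absolutely summable complex `T` -/

/-- **`count = ∑_{(κ,s)} (∏ w) δ_{s·κ}` on `ℤ^L`.** [cite: FrohlichSpencerCMP1982, §2.6 (2.37)–(2.40)] -/
theorem count_eq_sum_pairWeight_dirac (u : ℕ → ℝ≥0∞) (hu : ∑' k, u k = 1)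
    (L : Type*) [Fintype L] [DecidableEq L] :
    (Measure.count : Measure (L → ℤ)) =
      Measure.sum fun p : (L → ℕ) × (L → SignType) =>
        (∏ l, pairWeight u (p.1 l) (p.2 l)) • Measure.dirac (signMul p.2 p.1) := by
  refine Measure.ext_of_singleton fun q => ?_
  rw [Measure.count_singleton, Measure.sum_apply _ (measurableSet_singleton q)]
  have key := tsum_eq_tsum_sum_pairWeight u hu L (Set.indicator {q} 1)
  have h1 : ∑' q' : L → ℤ, Set.indicator {q} (1 : (L → ℤ) → ℝ≥0∞) q' = 1 := by
    simp_rw [Set.indicator_apply, Set.mem_singleton_iff, Pi.one_apply]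
    exact tsum_ite_eq q 1
  rw [h1] at key
  rw [key, ENNReal.tsum_prod']
  refine tsum_congr fun κ => ?_
  rw [tsum_fintype]
  refine Finset.sum_congr rfl fun s _ => ?_
  rw [Measure.smul_apply, smul_eq_mul, Measure.dirac_apply' _ (measurableSet_singleton q)]

/-- **The Fröhlich–Spencer resummation of `ℤ^L` for absolutely summable complex `T`**:
`∑'_{q ∈ ℤ^L} T q = ∑'_{(κ,s)} (∏_l w(κ_l,s_l)) T(s·κ)` (the right side absolutely convergent).
[cite: FrohlichSpencerCMP1982, §2.6 (2.37)–(2.40) p. 424] -/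
theorem tsum_eq_tsum_pairWeight_of_summable (u : ℕ → ℝ≥0∞) (hu : ∑' k, u k = 1)
    {L : Type*} [Fintype L] [DecidableEq L] (T : (L → ℤ) → ℂ) (hT : Summable fun q => ‖T q‖) :
    Summable (fun p : (L → ℕ) × (L → SignType) =>
        (∏ l, pairWeight u (p.1 l) (p.2 l)).toReal * ‖T (signMul p.2 p.1)‖) ∧
      ∑' q, T q = ∑' p : (L → ℕ) × (L → SignType),
        (∏ l, pairWeight u (p.1 l) (p.2 l)).toReal • T (signMul p.2 p.1) := by
  set c : (L → ℕ) × (L → SignType) → ℝ≥0∞ := fun p => ∏ l, pairWeight u (p.1 l) (p.2 l) with hc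
  have hc_ne : ∀ p, c p ≠ ∞ := fun p =>
    ENNReal.prod_ne_top fun l _ => pairWeight_ne_top hu _ _
  -- absolute convergence of the right side, from the `ℝ≥0∞` identity for `‖T‖ₑ`
  have hE := tsum_eq_tsum_sum_pairWeight u hu L fun q => ‖T q‖ₑ
  have hx : ∑' p : (L → ℕ) × (L → SignType), c p * ‖T (signMul p.2 p.1)‖ₑ = ∑' q, ‖T q‖ₑ := by
    rw [hE, ENNReal.tsum_prod']
    exact tsum_congr fun κ => by rw [tsum_fintype]
  have hfin : ∑' q, ‖T q‖ₑ ≠ ∞ := by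
    have h1 : ∀ q, ‖T q‖ₑ = ENNReal.ofReal ‖T q‖ := fun q => (ofReal_norm (T q)).symm
    simp_rw [h1]
    rw [← ENNReal.ofReal_tsum_of_nonneg (fun q => norm_nonneg _) hT]
    exact ENNReal.ofReal_ne_top
  have hsum : Summable fun p : (L → ℕ) × (L → SignType) => (c p).toReal * ‖T (signMul p.2 p.1)‖ := by
    have h := ENNReal.summable_toReal (f := fun p : (L → ℕ) × (L → SignType) =>
      c p * ‖T (signMul p.2 p.1)‖ₑ) (by rw [hx]; exact hfin)
    refine h.congr fun p => ?_
    rw [ENNReal.toReal_mul, toReal_enorm]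
  refine ⟨hsum, ?_⟩
  -- the identity, through the counting measure
  have hint : Integrable T (Measure.count : Measure (L → ℤ)) := integrable_count_iff.2 hT
  have h1 : ∑' q, T q = ∫ q, T q ∂(Measure.count : Measure (L → ℤ)) := by
    rw [integral_countable hint]
    exact tsum_congr fun q => by simp [measureReal_def]
  rw [h1, count_eq_sum_pairWeight_dirac u hu L, integral_sum_dirac_eq_tsum hc_ne hsum]

end EnsembleExpansion

end Literature.Probability.LatticeModels
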